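import Mathlib

/-!
# Venture AbcShadow — SH-04 STATEMENT ([BD10] closure): `x⁵ + y⁵ = 13 z⁷` has no non-trivial primitive solution

HONEST FRAMING. Statement file of the work-bound cell `abc-shadow` (row SH-04 of its census, sub-row "[BD10] `(d, p) = (13, 7)`";
typer seat `abc-shadow-typ-1`, lineage g4). This file PROVES NOTHING about the equation: it types the TARGET as a plain `Prop`
(`SH04BD13_7`) with EXACTLY the printed conventions of [BD10] = N. Billerey, L. V. Dieulefait, "Solving Fermat-type equations
`x⁵ + y⁵ = dz^p`", Math. Comp. 79 (2010) 535–544, §1 p. 1: "a solution `(a,b,c)` of the equation `x⁵+y⁵=dz^p` is primitive if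
`(a,b)=1` and non-trivial if `c ≠ 0`" — the same conventions as the landed sibling `SH04/StatementBD13_11.lean` (`SH04BD13_11`,
the pair `(13, 11)`). IN PRINT: [BD10, Thm 3.3] "The equation `x⁵+y⁵=13z^p` does not have non-trivial primitive solutions for
`p ≥ 19`"; the exponent `p = 7` typed here is OUTSIDE the printed range (`sh04BD13_7_outside_print`) — it is the cell's COMPUTED +
INDEPENDENTLY RE-CHECKED closure (certificate 4a36c28685fe0350 part D + eng-2 μ1–μ4/μ2c, crit-1-L2-SH04.md and
crit-1-SH04-137-K3.md: at `p = 7` every newform orbit of levels 650, 2600, 5200 is excluded — 102 of 110 by traces, the seven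
rational trace-survivors by the image of inertia at 5 [Bil07 L.2.8 + L.4.1], and the last pair `5200.42 @ (7, θ − 4)` by a computed
Sturm congruence with the mod-7-REDUCIBLE curve 5200bc1 against [Bil07 Prop 3.1]). ADJACENT result (generalized Fermat, signature
`(5, 5, 7)`), NOT abc: nothing here is a claim on the abc conjecture or on any summit, and nothing here takes a side on IUT. The
conditional derivation (typed/kernel-checked REDUCTION to the named [BD10]/[Bil07] inputs + the COMPUTED newform data entering as
`DataComplete` + the two named exclusion kinds) is `SH04/RowBD13_7.lean`.
-/

namespace Summit.Ventures.AbcShadow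

/-- **SH-04, [BD10] pair `(d, p) = (13, 7)`** (census row of the cell `abc-shadow`): the equation `x⁵ + y⁵ = 13 z⁷` has NO
solution in integers `x, y, z` with `(x, y) = 1` ("primitive") and `z ≠ 0` ("non-trivial") — [BD10, Thm 3.3]'s conclusion at
the exponent `p = 7`, which print (`p ≥ 19`) does not cover. Plain `Prop`; nothing is asserted here. ADJACENT, NOT abc.
[cite: BillereyDieulefait2010, Thm 3.3 and §1 p.1 (conventions; the exponent 7 is outside the printed range p ≥ 19)] -/
def SH04BD13_7 : Prop :=
  ∀ x y z : ℤ, IsCoprime x y → z ≠ 0 → x ^ 5 + y ^ 5 ≠ 13 * z ^ 7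

/-- Bookkeeping [cite: BillereyDieulefait2010, Thm 3.3]: the printed range is `p ≥ 19`; the exponent `7` is the least prime of the
standing range `p ≥ 7` of [BD10, §1], below the printed bound, and `7 ≠ 13` (so [Bil07] gives weight 2, as used in [BD10, §3.3]). -/
theorem sh04BD13_7_outside_print : Nat.Prime 7 ∧ 7 ≤ 7 ∧ 7 < 19 ∧ (7 : ℕ) ≠ 13 := by
  refine ⟨by norm_num, le_rfl, by norm_num, by norm_num⟩

end Summit.Ventures.AbcShadow
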